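import Summits.CriticalPhenomena.PercolationContinuityZ3.Theorems.SahiMasterFamilyPrincipalCapBeta
import Summits.CriticalPhenomena.PercolationContinuityZ3.Theorems.SahiMasterFamilyPrincipalCapC5Cert
import Literature.Combinatorics.Sahi2008.SetPartitionForm
import Literature.Combinatorics.Sahi2008.CumulationCone

/-!
# `F(n)` for `n ≤ 5`: the abstract principal-cap inequalities `PhiNonneg 3, 4, 5` are theorems

Unit `prim-masterthm-p4` (gen 13; crux anchor stmt-CriticalPhenomena-4575, helper work; memo
`run/shared/lean/prim/prim-masterthm/prim-masterthm-p4/P4-GEN13-REPORT.md` §1–2).  Companion of `…PrincipalCapBeta` (the all-orders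
β-normal form `E_{k+1} = (∏ P_j)·Φ_{k+1}(β)` and the reduction `PhiNonneg (k+1) ⇒ C_{k+1}` on the principal-cap stratum).

* `ex_realW_prod`, `phiSet_eq_sahiE_real` — **every set function is a moment function**: for `β : Finset (Fin n) → ℝ`, the SIGNED
  weight `realW β` (a Möbius transform, via the tree's `mobiusInv` / `cumul_mobiusInv` [Sahi2008, Lemma 8]) on `Finset (Fin n)` and the
  coordinate indicators `realF i = 1_{i ∈ ·}` have `E(∏_{i∈T} realF i) = β T` for every `T`; hence `Φ_n(β) = E_n(realW β; realF)` —
  the formal functional IS Sahi's `E_n` of a canonical signed model (so the printed `E_3, E_4, E_5` give `Φ_3, Φ_4, Φ_5` verbatim: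
  `phiSet_three`, `phiSet_four`, `phiSet_five`).
* `phiNonneg_three`, `phiNonneg_four`, `phiNonneg_five` — **`F(3), F(4), F(5)` hold**: `Φ_n(β) ≥ 0` for every `β` with values in `[0,1]`,
  `β univ = 1`, `β S · β T ≤ β (S ∪ T)`; the certificates are gen 12's `key_ineq4` and gen 13's `key_ineq5` read with all core probabilities
  `P_j = 1` (order three: `2 − Σ β_i + ∏ β_i = (1−β₀)(1−β₁) + (1−β₂)(1−β₀β₁)`).  With `PrincipalCapBeta.sahiE_ind_nonneg_of_phiNonneg` this is
  a second, uniform proof of Sahi's `C₃, C₄, C₅` on the principal-cap stratum (`…PrincipalCapC3/C4/C5`).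
HONEST FRAMING: `F(6)` and beyond are OPEN (numerically true; the disjoint-only variant is false at six); `C_k` in general OPEN.
Axioms standard. [this work]
-/

noncomputable section

open scoped Classical

namespace Summit.CriticalPhenomena.PercolationContinuityZ3.Theorems

namespace PrincipalCapBeta

open Finset Function
open Literature.Combinatorics.Sahi2008

/-! ### Every set function is a moment function (signed canonical model) -/

section Realize

variable {n : ℕ}

/-- Coordinate indicators on the Boolean lattice: `realF i (S) = [i ∈ S]`. [this work] -/
def realF (i : Fin n) : Finset (Fin n) → ℝ := fun S => if i ∈ S then 1 else 0

/-- The canonical signed weight realizing `β` as UPWARD moments: the Möbius transform of `X ↦ β(univ ∖ X)`, reflected.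
[cite: Sahi2008, Lemma 8 (p. 216)] -/
def realW (β : Finset (Fin n) → ℝ) (S : Finset (Fin n)) : ℝ := mobiusInv (fun X => β (univ \ X)) (univ \ S)

/-- Products of coordinate indicators are indicators of supersets. [folklore] -/
theorem prod_realF_apply (T S : Finset (Fin n)) : (∏ i ∈ T, realF i) S = if T ⊆ S then 1 else 0 := by
  rw [Finset.prod_apply]
  unfold realF
  rw [Finset.prod_boole]
  by_cases h : T ⊆ S
  · rw [if_pos h, if_pos fun i hi => h hi]
  · rw [if_neg h, if_neg fun h' => h fun i hi => h' i hi]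

/-- **`E_{realW β}(∏_{i∈T} realF i) = β T`** for every `T` (Möbius inversion, `cumul_mobiusInv`). [this work] -/
theorem ex_realW_prod (β : Finset (Fin n) → ℝ) (T : Finset (Fin n)) : ex (realW β) (∏ i ∈ T, realF i) = β T := by
  rw [ex_def]
  simp only [prod_realF_apply, mul_ite, mul_one, mul_zero]
  rw [← Finset.sum_filter]
  have h : ∑ S ∈ univ.filter (fun S : Finset (Fin n) => T ⊆ S), realW β S =
      ∑ U ∈ (univ \ T).powerset, mobiusInv (fun X => β (univ \ X)) U := by
    refine Finset.sum_nbij' (fun S => univ \ S) (fun U => univ \ U) ?_ ?_ ?_ ?_ ?_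
    · intro S hS
      rw [mem_powerset]
      exact sdiff_subset_sdiff (subset_refl _) (mem_filter.1 hS).2
    · intro U hU
      refine mem_filter.2 ⟨mem_univ _, ?_⟩
      have hU' : U ⊆ univ \ T := mem_powerset.1 hU
      intro x hx
      rw [mem_sdiff]
      exact ⟨mem_univ _, fun hxU => (mem_sdiff.1 (hU' hxU)).2 hx⟩
    · intro S _; exact _root_.sdiff_sdiff_eq_self (subset_univ S)
    · intro U _; exact _root_.sdiff_sdiff_eq_self (subset_univ U)
    · intro S _; rfl
  rw [h, cumul_mobiusInv, _root_.sdiff_sdiff_eq_self (subset_univ T)]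

/-- **`Φ_{n+1}(β) = E_{n+1}(realW β; realF)`**: the formal functional is Sahi's `E_{n+1}` of the canonical signed model. [this work] -/
theorem phiSet_eq_sahiE_real (β : Finset (Fin (n + 1)) → ℝ) : phiSet (n + 1) β = sahiE (realW β) (n + 1) realF := by
  rw [sahiE_eq_phiSet]
  congr 1
  funext B
  exact (ex_realW_prod β B).symm

end Realize

/-! ### `Φ_3, Φ_4, Φ_5` written out (the printed `E_3, E_4, E_5`) -/

/-- `Φ_3(β) = 2β_⊤ + β₀β₁β₂ − Σ_i β_i β_{jk}`. [this work] -/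
theorem phiSet_three (β : Finset (Fin 3) → ℝ) :
    phiSet 3 β = 2 * (β univ) + (β {0}) * (β {1}) * (β {2}) -
      ((β {0}) * (β {1, 2}) + (β {1}) * (β {0, 2}) + (β {2}) * (β {0, 1})) := by
  rw [phiSet_eq_sahiE_real]
  have hf : (realF : Fin 3 → Finset (Fin 3) → ℝ) = ![realF (0 : Fin 3), realF (1 : Fin 3), realF (2 : Fin 3)] := by
    funext i; fin_cases i <;> rfl
  have e0 : ex (realW β) (realF (0 : Fin 3)) = β {0} := by
    rw [← Finset.prod_singleton (f := realF) (0 : Fin 3)]; exact ex_realW_prod β _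
  have e1 : ex (realW β) (realF (1 : Fin 3)) = β {1} := by
    rw [← Finset.prod_singleton (f := realF) (1 : Fin 3)]; exact ex_realW_prod β _
  have e2 : ex (realW β) (realF (2 : Fin 3)) = β {2} := by
    rw [← Finset.prod_singleton (f := realF) (2 : Fin 3)]; exact ex_realW_prod β _
  have e01 : ex (realW β) (realF (0 : Fin 3) * realF (1 : Fin 3)) = β {0, 1} := by
    have hp : realF (0 : Fin 3) * realF (1 : Fin 3) = ∏ i ∈ ({0, 1} : Finset (Fin 3)), realF i := by
      rw [Finset.prod_insert (by decide), Finset.prod_singleton]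
    rw [hp]; exact ex_realW_prod β _
  have e02 : ex (realW β) (realF (0 : Fin 3) * realF (2 : Fin 3)) = β {0, 2} := by
    have hp : realF (0 : Fin 3) * realF (2 : Fin 3) = ∏ i ∈ ({0, 2} : Finset (Fin 3)), realF i := by
      rw [Finset.prod_insert (by decide), Finset.prod_singleton]
    rw [hp]; exact ex_realW_prod β _
  have e12 : ex (realW β) (realF (1 : Fin 3) * realF (2 : Fin 3)) = β {1, 2} := by
    have hp : realF (1 : Fin 3) * realF (2 : Fin 3) = ∏ i ∈ ({1, 2} : Finset (Fin 3)), realF i := by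
      rw [Finset.prod_insert (by decide), Finset.prod_singleton]
    rw [hp]; exact ex_realW_prod β _
  have e012 : ex (realW β) (realF (0 : Fin 3) * realF (1 : Fin 3) * realF (2 : Fin 3)) = β univ := by
    have hp : realF (0 : Fin 3) * realF (1 : Fin 3) * realF (2 : Fin 3) = ∏ i ∈ ({0, 1, 2} : Finset (Fin 3)), realF i := by
      rw [Finset.prod_insert (by decide), Finset.prod_insert (by decide), Finset.prod_singleton]; simp only [mul_assoc]
    have hu : ({0, 1, 2} : Finset (Fin 3)) = Finset.univ := by decide
    rw [hp, ← hu]; exact ex_realW_prod β _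
  rw [hf, sahiE_three, e0, e1, e2, e01, e02, e12, e012]

/-- `Φ_4(β)`, Lieb–Sahi's display of `E_4`. [this work] -/
theorem phiSet_four (β : Finset (Fin 4) → ℝ) :
    phiSet 4 β =
      6 * (β univ)
      - 2 * ((β {0}) * (β {1, 2, 3}) + (β {1}) * (β {0, 2, 3}) + (β {2}) * (β {0, 1, 3}) +
          (β {3}) * (β {0, 1, 2}))
      + ((β {0}) * (β {1}) * (β {2, 3}) + (β {0}) * (β {2}) * (β {1, 3}) + (β {0}) * (β {3}) * (β {1, 2}) +
          (β {1}) * (β {2}) * (β {0, 3}) + (β {1}) * (β {3}) * (β {0, 2}) + (β {2}) * (β {3}) * (β {0, 1}))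
      - ((β {0, 1}) * (β {2, 3}) + (β {0, 2}) * (β {1, 3}) + (β {0, 3}) * (β {1, 2}))
      - (β {0}) * (β {1}) * (β {2}) * (β {3}) := by
  rw [phiSet_eq_sahiE_real]
  have hf : (realF : Fin 4 → Finset (Fin 4) → ℝ) = ![realF (0 : Fin 4), realF (1 : Fin 4), realF (2 : Fin 4), realF (3 : Fin 4)] := by
    funext i; fin_cases i <;> rfl
  have e0 : ex (realW β) (realF (0 : Fin 4)) = β {0} := by
    rw [← Finset.prod_singleton (f := realF) (0 : Fin 4)]; exact ex_realW_prod β _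
  have e1 : ex (realW β) (realF (1 : Fin 4)) = β {1} := by
    rw [← Finset.prod_singleton (f := realF) (1 : Fin 4)]; exact ex_realW_prod β _
  have e2 : ex (realW β) (realF (2 : Fin 4)) = β {2} := by
    rw [← Finset.prod_singleton (f := realF) (2 : Fin 4)]; exact ex_realW_prod β _
  have e3 : ex (realW β) (realF (3 : Fin 4)) = β {3} := by
    rw [← Finset.prod_singleton (f := realF) (3 : Fin 4)]; exact ex_realW_prod β _
  have e01 : ex (realW β) (realF (0 : Fin 4) * realF (1 : Fin 4)) = β {0, 1} := by
    have hp : realF (0 : Fin 4) * realF (1 : Fin 4) = ∏ i ∈ ({0, 1} : Finset (Fin 4)), realF i := by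
      rw [Finset.prod_insert (by decide), Finset.prod_singleton]
    rw [hp]; exact ex_realW_prod β _
  have e02 : ex (realW β) (realF (0 : Fin 4) * realF (2 : Fin 4)) = β {0, 2} := by
    have hp : realF (0 : Fin 4) * realF (2 : Fin 4) = ∏ i ∈ ({0, 2} : Finset (Fin 4)), realF i := by
      rw [Finset.prod_insert (by decide), Finset.prod_singleton]
    rw [hp]; exact ex_realW_prod β _
  have e03 : ex (realW β) (realF (0 : Fin 4) * realF (3 : Fin 4)) = β {0, 3} := by
    have hp : realF (0 : Fin 4) * realF (3 : Fin 4) = ∏ i ∈ ({0, 3} : Finset (Fin 4)), realF i := by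
      rw [Finset.prod_insert (by decide), Finset.prod_singleton]
    rw [hp]; exact ex_realW_prod β _
  have e12 : ex (realW β) (realF (1 : Fin 4) * realF (2 : Fin 4)) = β {1, 2} := by
    have hp : realF (1 : Fin 4) * realF (2 : Fin 4) = ∏ i ∈ ({1, 2} : Finset (Fin 4)), realF i := by
      rw [Finset.prod_insert (by decide), Finset.prod_singleton]
    rw [hp]; exact ex_realW_prod β _
  have e13 : ex (realW β) (realF (1 : Fin 4) * realF (3 : Fin 4)) = β {1, 3} := by
    have hp : realF (1 : Fin 4) * realF (3 : Fin 4) = ∏ i ∈ ({1, 3} : Finset (Fin 4)), realF i := by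
      rw [Finset.prod_insert (by decide), Finset.prod_singleton]
    rw [hp]; exact ex_realW_prod β _
  have e23 : ex (realW β) (realF (2 : Fin 4) * realF (3 : Fin 4)) = β {2, 3} := by
    have hp : realF (2 : Fin 4) * realF (3 : Fin 4) = ∏ i ∈ ({2, 3} : Finset (Fin 4)), realF i := by
      rw [Finset.prod_insert (by decide), Finset.prod_singleton]
    rw [hp]; exact ex_realW_prod β _
  have e012 : ex (realW β) (realF (0 : Fin 4) * realF (1 : Fin 4) * realF (2 : Fin 4)) = β {0, 1, 2} := by
    have hp : realF (0 : Fin 4) * realF (1 : Fin 4) * realF (2 : Fin 4) = ∏ i ∈ ({0, 1, 2} : Finset (Fin 4)), realF i := by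
      rw [Finset.prod_insert (by decide), Finset.prod_insert (by decide), Finset.prod_singleton]; simp only [mul_assoc]
    rw [hp]; exact ex_realW_prod β _
  have e013 : ex (realW β) (realF (0 : Fin 4) * realF (1 : Fin 4) * realF (3 : Fin 4)) = β {0, 1, 3} := by
    have hp : realF (0 : Fin 4) * realF (1 : Fin 4) * realF (3 : Fin 4) = ∏ i ∈ ({0, 1, 3} : Finset (Fin 4)), realF i := by
      rw [Finset.prod_insert (by decide), Finset.prod_insert (by decide), Finset.prod_singleton]; simp only [mul_assoc]
    rw [hp]; exact ex_realW_prod β _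
  have e023 : ex (realW β) (realF (0 : Fin 4) * realF (2 : Fin 4) * realF (3 : Fin 4)) = β {0, 2, 3} := by
    have hp : realF (0 : Fin 4) * realF (2 : Fin 4) * realF (3 : Fin 4) = ∏ i ∈ ({0, 2, 3} : Finset (Fin 4)), realF i := by
      rw [Finset.prod_insert (by decide), Finset.prod_insert (by decide), Finset.prod_singleton]; simp only [mul_assoc]
    rw [hp]; exact ex_realW_prod β _
  have e123 : ex (realW β) (realF (1 : Fin 4) * realF (2 : Fin 4) * realF (3 : Fin 4)) = β {1, 2, 3} := by
    have hp : realF (1 : Fin 4) * realF (2 : Fin 4) * realF (3 : Fin 4) = ∏ i ∈ ({1, 2, 3} : Finset (Fin 4)), realF i := by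
      rw [Finset.prod_insert (by decide), Finset.prod_insert (by decide), Finset.prod_singleton]; simp only [mul_assoc]
    rw [hp]; exact ex_realW_prod β _
  have e0123 : ex (realW β) (realF (0 : Fin 4) * realF (1 : Fin 4) * realF (2 : Fin 4) * realF (3 : Fin 4)) = β univ := by
    have hp : realF (0 : Fin 4) * realF (1 : Fin 4) * realF (2 : Fin 4) * realF (3 : Fin 4) = ∏ i ∈ ({0, 1, 2, 3} : Finset (Fin 4)), realF i := by
      rw [Finset.prod_insert (by decide), Finset.prod_insert (by decide), Finset.prod_insert (by decide), Finset.prod_singleton]; simp only [mul_assoc]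
    have hu : ({0, 1, 2, 3} : Finset (Fin 4)) = Finset.univ := by decide
    rw [hp, ← hu]; exact ex_realW_prod β _
  rw [hf, sahiE_four, e0, e1, e2, e3, e01, e02, e03, e12, e13, e23, e012, e013, e023, e123, e0123]

set_option maxHeartbeats 4000000 in
/-- `Φ_5(β)`, Sahi's printed `E_5`. [this work] -/
theorem phiSet_five (β : Finset (Fin 5) → ℝ) :
    phiSet 5 β =
      24 * (β univ)
      - 6 * ((β {1, 2, 3, 4}) * (β {0}) + (β {0, 2, 3, 4}) * (β {1}) + (β {0, 1, 3, 4}) * (β {2})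
             + (β {0, 1, 2, 4}) * (β {3}) + (β {0, 1, 2, 3}) * (β {4}))
      - 2 * ((β {0, 1, 2}) * (β {3, 4}) + (β {0, 1, 3}) * (β {2, 4}) + (β {0, 1, 4}) * (β {2, 3})
             + (β {0, 2, 3}) * (β {1, 4}) + (β {0, 2, 4}) * (β {1, 3}) + (β {0, 3, 4}) * (β {1, 2})
             + (β {1, 2, 3}) * (β {0, 4}) + (β {1, 2, 4}) * (β {0, 3}) + (β {1, 3, 4}) * (β {0, 2})
             + (β {2, 3, 4}) * (β {0, 1}))
      + 2 * ((β {0, 1, 2}) * (β {3}) * (β {4}) + (β {0, 1, 3}) * (β {2}) * (β {4}) + (β {0, 1, 4}) * (β {2}) * (β {3})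
             + (β {0, 2, 3}) * (β {1}) * (β {4}) + (β {0, 2, 4}) * (β {1}) * (β {3}) + (β {0, 3, 4}) * (β {1}) * (β {2})
             + (β {1, 2, 3}) * (β {0}) * (β {4}) + (β {1, 2, 4}) * (β {0}) * (β {3}) + (β {1, 3, 4}) * (β {0}) * (β {2})
             + (β {2, 3, 4}) * (β {0}) * (β {1}))
      + ((β {0, 1}) * (β {2, 3}) * (β {4}) + (β {0, 1}) * (β {2, 4}) * (β {3}) + (β {0, 1}) * (β {3, 4}) * (β {2})
         + (β {0, 2}) * (β {1, 3}) * (β {4}) + (β {0, 2}) * (β {1, 4}) * (β {3}) + (β {0, 2}) * (β {3, 4}) * (β {1})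
         + (β {0, 3}) * (β {1, 2}) * (β {4}) + (β {0, 3}) * (β {1, 4}) * (β {2}) + (β {0, 3}) * (β {2, 4}) * (β {1})
         + (β {0, 4}) * (β {1, 2}) * (β {3}) + (β {0, 4}) * (β {1, 3}) * (β {2}) + (β {0, 4}) * (β {2, 3}) * (β {1})
         + (β {1, 2}) * (β {3, 4}) * (β {0}) + (β {1, 3}) * (β {2, 4}) * (β {0}) + (β {1, 4}) * (β {2, 3}) * (β {0}))
      - ((β {0, 1}) * (β {2}) * (β {3}) * (β {4}) + (β {0, 2}) * (β {1}) * (β {3}) * (β {4}) + (β {0, 3}) * (β {1}) * (β {2}) * (β {4})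
         + (β {0, 4}) * (β {1}) * (β {2}) * (β {3}) + (β {1, 2}) * (β {0}) * (β {3}) * (β {4}) + (β {1, 3}) * (β {0}) * (β {2}) * (β {4})
         + (β {1, 4}) * (β {0}) * (β {2}) * (β {3}) + (β {2, 3}) * (β {0}) * (β {1}) * (β {4}) + (β {2, 4}) * (β {0}) * (β {1}) * (β {3})
         + (β {3, 4}) * (β {0}) * (β {1}) * (β {2}))
      + (β {0}) * (β {1}) * (β {2}) * (β {3}) * (β {4}) := by
  rw [phiSet_eq_sahiE_real]
  have hf : (realF : Fin 5 → Finset (Fin 5) → ℝ) = ![realF (0 : Fin 5), realF (1 : Fin 5), realF (2 : Fin 5), realF (3 : Fin 5), realF (4 : Fin 5)] := by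
    funext i; fin_cases i <;> rfl
  have e0 : ex (realW β) (realF (0 : Fin 5)) = β {0} := by
    rw [← Finset.prod_singleton (f := realF) (0 : Fin 5)]; exact ex_realW_prod β _
  have e1 : ex (realW β) (realF (1 : Fin 5)) = β {1} := by
    rw [← Finset.prod_singleton (f := realF) (1 : Fin 5)]; exact ex_realW_prod β _
  have e2 : ex (realW β) (realF (2 : Fin 5)) = β {2} := by
    rw [← Finset.prod_singleton (f := realF) (2 : Fin 5)]; exact ex_realW_prod β _
  have e3 : ex (realW β) (realF (3 : Fin 5)) = β {3} := by
    rw [← Finset.prod_singleton (f := realF) (3 : Fin 5)]; exact ex_realW_prod β _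
  have e4 : ex (realW β) (realF (4 : Fin 5)) = β {4} := by
    rw [← Finset.prod_singleton (f := realF) (4 : Fin 5)]; exact ex_realW_prod β _
  have e01 : ex (realW β) (realF (0 : Fin 5) * realF (1 : Fin 5)) = β {0, 1} := by
    have hp : realF (0 : Fin 5) * realF (1 : Fin 5) = ∏ i ∈ ({0, 1} : Finset (Fin 5)), realF i := by
      rw [Finset.prod_insert (by decide), Finset.prod_singleton]
    rw [hp]; exact ex_realW_prod β _
  have e02 : ex (realW β) (realF (0 : Fin 5) * realF (2 : Fin 5)) = β {0, 2} := by
    have hp : realF (0 : Fin 5) * realF (2 : Fin 5) = ∏ i ∈ ({0, 2} : Finset (Fin 5)), realF i := by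
      rw [Finset.prod_insert (by decide), Finset.prod_singleton]
    rw [hp]; exact ex_realW_prod β _
  have e03 : ex (realW β) (realF (0 : Fin 5) * realF (3 : Fin 5)) = β {0, 3} := by
    have hp : realF (0 : Fin 5) * realF (3 : Fin 5) = ∏ i ∈ ({0, 3} : Finset (Fin 5)), realF i := by
      rw [Finset.prod_insert (by decide), Finset.prod_singleton]
    rw [hp]; exact ex_realW_prod β _
  have e04 : ex (realW β) (realF (0 : Fin 5) * realF (4 : Fin 5)) = β {0, 4} := by
    have hp : realF (0 : Fin 5) * realF (4 : Fin 5) = ∏ i ∈ ({0, 4} : Finset (Fin 5)), realF i := by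
      rw [Finset.prod_insert (by decide), Finset.prod_singleton]
    rw [hp]; exact ex_realW_prod β _
  have e12 : ex (realW β) (realF (1 : Fin 5) * realF (2 : Fin 5)) = β {1, 2} := by
    have hp : realF (1 : Fin 5) * realF (2 : Fin 5) = ∏ i ∈ ({1, 2} : Finset (Fin 5)), realF i := by
      rw [Finset.prod_insert (by decide), Finset.prod_singleton]
    rw [hp]; exact ex_realW_prod β _
  have e13 : ex (realW β) (realF (1 : Fin 5) * realF (3 : Fin 5)) = β {1, 3} := by
    have hp : realF (1 : Fin 5) * realF (3 : Fin 5) = ∏ i ∈ ({1, 3} : Finset (Fin 5)), realF i := by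
      rw [Finset.prod_insert (by decide), Finset.prod_singleton]
    rw [hp]; exact ex_realW_prod β _
  have e14 : ex (realW β) (realF (1 : Fin 5) * realF (4 : Fin 5)) = β {1, 4} := by
    have hp : realF (1 : Fin 5) * realF (4 : Fin 5) = ∏ i ∈ ({1, 4} : Finset (Fin 5)), realF i := by
      rw [Finset.prod_insert (by decide), Finset.prod_singleton]
    rw [hp]; exact ex_realW_prod β _
  have e23 : ex (realW β) (realF (2 : Fin 5) * realF (3 : Fin 5)) = β {2, 3} := by
    have hp : realF (2 : Fin 5) * realF (3 : Fin 5) = ∏ i ∈ ({2, 3} : Finset (Fin 5)), realF i := by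
      rw [Finset.prod_insert (by decide), Finset.prod_singleton]
    rw [hp]; exact ex_realW_prod β _
  have e24 : ex (realW β) (realF (2 : Fin 5) * realF (4 : Fin 5)) = β {2, 4} := by
    have hp : realF (2 : Fin 5) * realF (4 : Fin 5) = ∏ i ∈ ({2, 4} : Finset (Fin 5)), realF i := by
      rw [Finset.prod_insert (by decide), Finset.prod_singleton]
    rw [hp]; exact ex_realW_prod β _
  have e34 : ex (realW β) (realF (3 : Fin 5) * realF (4 : Fin 5)) = β {3, 4} := by
    have hp : realF (3 : Fin 5) * realF (4 : Fin 5) = ∏ i ∈ ({3, 4} : Finset (Fin 5)), realF i := by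
      rw [Finset.prod_insert (by decide), Finset.prod_singleton]
    rw [hp]; exact ex_realW_prod β _
  have e012 : ex (realW β) (realF (0 : Fin 5) * realF (1 : Fin 5) * realF (2 : Fin 5)) = β {0, 1, 2} := by
    have hp : realF (0 : Fin 5) * realF (1 : Fin 5) * realF (2 : Fin 5) = ∏ i ∈ ({0, 1, 2} : Finset (Fin 5)), realF i := by
      rw [Finset.prod_insert (by decide), Finset.prod_insert (by decide), Finset.prod_singleton]; simp only [mul_assoc]
    rw [hp]; exact ex_realW_prod β _
  have e013 : ex (realW β) (realF (0 : Fin 5) * realF (1 : Fin 5) * realF (3 : Fin 5)) = β {0, 1, 3} := by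
    have hp : realF (0 : Fin 5) * realF (1 : Fin 5) * realF (3 : Fin 5) = ∏ i ∈ ({0, 1, 3} : Finset (Fin 5)), realF i := by
      rw [Finset.prod_insert (by decide), Finset.prod_insert (by decide), Finset.prod_singleton]; simp only [mul_assoc]
    rw [hp]; exact ex_realW_prod β _
  have e014 : ex (realW β) (realF (0 : Fin 5) * realF (1 : Fin 5) * realF (4 : Fin 5)) = β {0, 1, 4} := by
    have hp : realF (0 : Fin 5) * realF (1 : Fin 5) * realF (4 : Fin 5) = ∏ i ∈ ({0, 1, 4} : Finset (Fin 5)), realF i := by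
      rw [Finset.prod_insert (by decide), Finset.prod_insert (by decide), Finset.prod_singleton]; simp only [mul_assoc]
    rw [hp]; exact ex_realW_prod β _
  have e023 : ex (realW β) (realF (0 : Fin 5) * realF (2 : Fin 5) * realF (3 : Fin 5)) = β {0, 2, 3} := by
    have hp : realF (0 : Fin 5) * realF (2 : Fin 5) * realF (3 : Fin 5) = ∏ i ∈ ({0, 2, 3} : Finset (Fin 5)), realF i := by
      rw [Finset.prod_insert (by decide), Finset.prod_insert (by decide), Finset.prod_singleton]; simp only [mul_assoc]
    rw [hp]; exact ex_realW_prod β _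
  have e024 : ex (realW β) (realF (0 : Fin 5) * realF (2 : Fin 5) * realF (4 : Fin 5)) = β {0, 2, 4} := by
    have hp : realF (0 : Fin 5) * realF (2 : Fin 5) * realF (4 : Fin 5) = ∏ i ∈ ({0, 2, 4} : Finset (Fin 5)), realF i := by
      rw [Finset.prod_insert (by decide), Finset.prod_insert (by decide), Finset.prod_singleton]; simp only [mul_assoc]
    rw [hp]; exact ex_realW_prod β _
  have e034 : ex (realW β) (realF (0 : Fin 5) * realF (3 : Fin 5) * realF (4 : Fin 5)) = β {0, 3, 4} := by
    have hp : realF (0 : Fin 5) * realF (3 : Fin 5) * realF (4 : Fin 5) = ∏ i ∈ ({0, 3, 4} : Finset (Fin 5)), realF i := by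
      rw [Finset.prod_insert (by decide), Finset.prod_insert (by decide), Finset.prod_singleton]; simp only [mul_assoc]
    rw [hp]; exact ex_realW_prod β _
  have e123 : ex (realW β) (realF (1 : Fin 5) * realF (2 : Fin 5) * realF (3 : Fin 5)) = β {1, 2, 3} := by
    have hp : realF (1 : Fin 5) * realF (2 : Fin 5) * realF (3 : Fin 5) = ∏ i ∈ ({1, 2, 3} : Finset (Fin 5)), realF i := by
      rw [Finset.prod_insert (by decide), Finset.prod_insert (by decide), Finset.prod_singleton]; simp only [mul_assoc]
    rw [hp]; exact ex_realW_prod β _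
  have e124 : ex (realW β) (realF (1 : Fin 5) * realF (2 : Fin 5) * realF (4 : Fin 5)) = β {1, 2, 4} := by
    have hp : realF (1 : Fin 5) * realF (2 : Fin 5) * realF (4 : Fin 5) = ∏ i ∈ ({1, 2, 4} : Finset (Fin 5)), realF i := by
      rw [Finset.prod_insert (by decide), Finset.prod_insert (by decide), Finset.prod_singleton]; simp only [mul_assoc]
    rw [hp]; exact ex_realW_prod β _
  have e134 : ex (realW β) (realF (1 : Fin 5) * realF (3 : Fin 5) * realF (4 : Fin 5)) = β {1, 3, 4} := by
    have hp : realF (1 : Fin 5) * realF (3 : Fin 5) * realF (4 : Fin 5) = ∏ i ∈ ({1, 3, 4} : Finset (Fin 5)), realF i := by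
      rw [Finset.prod_insert (by decide), Finset.prod_insert (by decide), Finset.prod_singleton]; simp only [mul_assoc]
    rw [hp]; exact ex_realW_prod β _
  have e234 : ex (realW β) (realF (2 : Fin 5) * realF (3 : Fin 5) * realF (4 : Fin 5)) = β {2, 3, 4} := by
    have hp : realF (2 : Fin 5) * realF (3 : Fin 5) * realF (4 : Fin 5) = ∏ i ∈ ({2, 3, 4} : Finset (Fin 5)), realF i := by
      rw [Finset.prod_insert (by decide), Finset.prod_insert (by decide), Finset.prod_singleton]; simp only [mul_assoc]
    rw [hp]; exact ex_realW_prod β _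
  have e0123 : ex (realW β) (realF (0 : Fin 5) * realF (1 : Fin 5) * realF (2 : Fin 5) * realF (3 : Fin 5)) = β {0, 1, 2, 3} := by
    have hp : realF (0 : Fin 5) * realF (1 : Fin 5) * realF (2 : Fin 5) * realF (3 : Fin 5) = ∏ i ∈ ({0, 1, 2, 3} : Finset (Fin 5)), realF i := by
      rw [Finset.prod_insert (by decide), Finset.prod_insert (by decide), Finset.prod_insert (by decide), Finset.prod_singleton]; simp only [mul_assoc]
    rw [hp]; exact ex_realW_prod β _
  have e0124 : ex (realW β) (realF (0 : Fin 5) * realF (1 : Fin 5) * realF (2 : Fin 5) * realF (4 : Fin 5)) = β {0, 1, 2, 4} := by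
    have hp : realF (0 : Fin 5) * realF (1 : Fin 5) * realF (2 : Fin 5) * realF (4 : Fin 5) = ∏ i ∈ ({0, 1, 2, 4} : Finset (Fin 5)), realF i := by
      rw [Finset.prod_insert (by decide), Finset.prod_insert (by decide), Finset.prod_insert (by decide), Finset.prod_singleton]; simp only [mul_assoc]
    rw [hp]; exact ex_realW_prod β _
  have e0134 : ex (realW β) (realF (0 : Fin 5) * realF (1 : Fin 5) * realF (3 : Fin 5) * realF (4 : Fin 5)) = β {0, 1, 3, 4} := by
    have hp : realF (0 : Fin 5) * realF (1 : Fin 5) * realF (3 : Fin 5) * realF (4 : Fin 5) = ∏ i ∈ ({0, 1, 3, 4} : Finset (Fin 5)), realF i := by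
      rw [Finset.prod_insert (by decide), Finset.prod_insert (by decide), Finset.prod_insert (by decide), Finset.prod_singleton]; simp only [mul_assoc]
    rw [hp]; exact ex_realW_prod β _
  have e0234 : ex (realW β) (realF (0 : Fin 5) * realF (2 : Fin 5) * realF (3 : Fin 5) * realF (4 : Fin 5)) = β {0, 2, 3, 4} := by
    have hp : realF (0 : Fin 5) * realF (2 : Fin 5) * realF (3 : Fin 5) * realF (4 : Fin 5) = ∏ i ∈ ({0, 2, 3, 4} : Finset (Fin 5)), realF i := by
      rw [Finset.prod_insert (by decide), Finset.prod_insert (by decide), Finset.prod_insert (by decide), Finset.prod_singleton]; simp only [mul_assoc]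
    rw [hp]; exact ex_realW_prod β _
  have e1234 : ex (realW β) (realF (1 : Fin 5) * realF (2 : Fin 5) * realF (3 : Fin 5) * realF (4 : Fin 5)) = β {1, 2, 3, 4} := by
    have hp : realF (1 : Fin 5) * realF (2 : Fin 5) * realF (3 : Fin 5) * realF (4 : Fin 5) = ∏ i ∈ ({1, 2, 3, 4} : Finset (Fin 5)), realF i := by
      rw [Finset.prod_insert (by decide), Finset.prod_insert (by decide), Finset.prod_insert (by decide), Finset.prod_singleton]; simp only [mul_assoc]
    rw [hp]; exact ex_realW_prod β _
  have e01234 : ex (realW β) (realF (0 : Fin 5) * realF (1 : Fin 5) * realF (2 : Fin 5) * realF (3 : Fin 5) * realF (4 : Fin 5)) = β univ := by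
    have hp : realF (0 : Fin 5) * realF (1 : Fin 5) * realF (2 : Fin 5) * realF (3 : Fin 5) * realF (4 : Fin 5) = ∏ i ∈ ({0, 1, 2, 3, 4} : Finset (Fin 5)), realF i := by
      rw [Finset.prod_insert (by decide), Finset.prod_insert (by decide), Finset.prod_insert (by decide), Finset.prod_insert (by decide), Finset.prod_singleton]; simp only [mul_assoc]
    have hu : ({0, 1, 2, 3, 4} : Finset (Fin 5)) = Finset.univ := by decide
    rw [hp, ← hu]; exact ex_realW_prod β _
  rw [hf, sahiE_five, e0, e1, e2, e3, e4, e01, e02, e03, e04, e12, e13, e14, e23, e24, e34, e012, e013, e014, e023, e024, e034, e123, e124, e134, e234, e0123, e0124, e0134, e0234, e1234, e01234]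

/-! ### `F(3)`, `F(4)`, `F(5)` -/

/-- **`F(3)`**: `Φ_3(β) ≥ 0` (box constraints suffice: `2 − Σβ_i + ∏β_i = (1−β₀)(1−β₁) + (1−β₂)(1−β₀β₁)`). [this work] -/
theorem phiNonneg_three : PhiNonneg 3 := by
  intro β h0 h1 htop _
  rw [phiSet_three, htop]
  have a0 := h0 {0}; have a1 := h0 {1}; have a2 := h0 {2}
  have b0 := h1 {0}; have b1 := h1 {1}; have b2 := h1 {2}
  have c0 : β {0} * β {1, 2} ≤ β {0} := by nlinarith [h1 {1, 2}, h0 {1, 2}]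
  have c1 : β {1} * β {0, 2} ≤ β {1} := by nlinarith [h1 {0, 2}, h0 {0, 2}]
  have c2 : β {2} * β {0, 1} ≤ β {2} := by nlinarith [h1 {0, 1}, h0 {0, 1}]
  have t1 : 0 ≤ (1 - β {0}) * (1 - β {1}) := mul_nonneg (sub_nonneg.2 b0) (sub_nonneg.2 b1)
  have t2 : 0 ≤ (1 - β {2}) * (1 - β {0} * β {1}) :=
    mul_nonneg (sub_nonneg.2 b2) (sub_nonneg.2 (mul_le_one₀ b0 a1 b1))
  nlinarith [t1, t2, c0, c1, c2]

/-- **`F(4)`**: `Φ_4(β) ≥ 0`, by gen 12's certificate `key_ineq4` read with all core probabilities `1`. [this work] -/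
theorem phiNonneg_four : PhiNonneg 4 := by
  intro β h0 h1 htop hsup
  rw [phiSet_four]
  have key := PrincipalCapC3.key_ineq4 (m0 := β {0}) (m1 := β {1}) (m2 := β {2}) (m3 := β {3}) (m01 := β {0, 1})
    (m02 := β {0, 2}) (m03 := β {0, 3}) (m12 := β {1, 2}) (m13 := β {1, 3}) (m23 := β {2, 3}) (m012 := β {0, 1, 2})
    (m013 := β {0, 1, 3}) (m023 := β {0, 2, 3}) (m123 := β {1, 2, 3}) (m0123 := β univ) (P0 := 1) (P1 := 1) (P2 := 1) (P3 := 1)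
    (h0 {0}) (h0 {1}) (h0 {2}) (h0 {3}) zero_le_one zero_le_one zero_le_one (by simpa using h1 {0}) (by simpa using h1 {1}) (by simpa using h1 {2}) (by simpa using h1 {3}) (by simpa using h1 {0, 1}) (by simpa using h1 {0, 2}) (by simpa using h1 {0, 3}) (by simpa using h1 {1, 2}) (by simpa using h1 {1, 3}) (by simpa using h1 {2, 3}) (by simpa using h1 {0, 1, 2}) (by simpa using h1 {0, 1, 3}) (by simpa using h1 {0, 2, 3}) (by simpa using h1 {1, 2, 3}) (by rw [htop]; norm_num) (by simpa using hsup {0} {2}) (by simpa using hsup {1} {2}) (by simpa using hsup {1} {3}) (by simpa using hsup {2} {3})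
  ring_nf at key ⊢
  linarith [key]

set_option maxHeartbeats 4000000 in
/-- **`F(5)`**: `Φ_5(β) ≥ 0`, by the symmetric certificate `key_ineq5` read with all core probabilities `1`. [this work] -/
theorem phiNonneg_five : PhiNonneg 5 := by
  intro β h0 h1 htop hsup
  rw [phiSet_five]
  have key := PrincipalCapC3.key_ineq5 (mA := β {0}) (mB := β {1}) (mC := β {2}) (mD := β {3}) (mE := β {4}) (mAB := β {0, 1}) (mAC := β {0, 2}) (mAD := β {0, 3}) (mAE := β {0, 4}) (mBC := β {1, 2}) (mBD := β {1, 3}) (mBE := β {1, 4}) (mCD := β {2, 3}) (mCE := β {2, 4}) (mDE := β {3, 4}) (mABC := β {0, 1, 2}) (mABD := β {0, 1, 3}) (mABE := β {0, 1, 4}) (mACD := β {0, 2, 3}) (mACE := β {0, 2, 4}) (mADE := β {0, 3, 4}) (mBCD := β {1, 2, 3}) (mBCE := β {1, 2, 4}) (mBDE := β {1, 3, 4}) (mCDE := β {2, 3, 4}) (mABCD := β {0, 1, 2, 3}) (mABCE := β {0, 1, 2, 4}) (mABDE := β {0, 1, 3, 4}) (mACDE := β {0, 2, 3, 4}) (mBCDE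 := β {1, 2, 3, 4}) (mABCDE := β univ)
    (PA := 1) (PB := 1) (PC := 1) (PD := 1) (PE := 1)
    (h0 {0}) (h0 {1}) (h0 {2}) (h0 {3}) (h0 {4}) (by simpa using h1 {0}) (by simpa using h1 {1}) (by simpa using h1 {2}) (by simpa using h1 {3}) (by simpa using h1 {4}) (by simpa using h1 {0, 1}) (by simpa using h1 {0, 2}) (by simpa using h1 {0, 3}) (by simpa using h1 {0, 4}) (by simpa using h1 {1, 2}) (by simpa using h1 {1, 3}) (by simpa using h1 {1, 4}) (by simpa using h1 {2, 3}) (by simpa using h1 {2, 4}) (by simpa using h1 {3, 4}) (by simpa using h1 {0, 1, 2}) (by simpa using h1 {0, 1, 3}) (by simpa using h1 {0, 1, 4}) (by simpa using h1 {0, 2, 3}) (by simpa using h1 {0, 2, 4}) (by simpa using h1 {0, 3, 4}) (by simpa using h1 {1, 2, 3}) (by simpa using h1 {1, 2, 4}) (by simpa using h1 {1, 3, 4}) (by simpa using h1 {2, 3, 4}) (by simpa using h1 {0, 1, 2, 3}) (by simpa using h1 {0, 1, 2, 4}) (by simpa using h1 {0, 1, 3, 4}) (by simpa using h1 {0, 2,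 3, 4}) (by simpa using h1 {1, 2, 3, 4}) (by simpa using hsup {0} {1}) (by simpa using hsup {0} {2}) (by simpa using hsup {0} {3}) (by simpa using hsup {0} {4}) (by simpa using hsup {1} {2}) (by simpa using hsup {1} {3}) (by simpa using hsup {1} {4}) (by simpa using hsup {2} {3}) (by simpa using hsup {2} {4}) (by simpa using hsup {3} {4}) (by rw [htop]; norm_num)
  ring_nf at key ⊢
  linarith [key]

end PrincipalCapBeta

end Summit.CriticalPhenomena.PercolationContinuityZ3.Theorems
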